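import Literature.NumberTheory.Automorphic.HyperspecialUnitaryHeckeEigencharacter
import Literature.NumberTheory.Automorphic.HeckeAlgebraDegree
import HarnessLib

/-!
# The degree character of `ℋ(U(σ, J₀), K₀)` is the unramified Hecke eigencharacter with parameter `δ_B^{-1/2}`
# (Cartier 1979 §IV (4.2)–(4.4); Shimura 1971 Prop. 3.3)

Topic `NumberTheory/Automorphic`; namespace `Literature.NumberTheory.Automorphic.HermitianLattice.UnramifiedLocalConjDatum`
(lane `lit-hodgefound`, Track 2 foundations; seat `lit-hodgefound-p11`, generation 36, row g36-#13).  THEOREMS ONLY: no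
definition, no named fact, no instance, no notation.  Joins `HyperspecialUnitaryHeckeEigencharacter` (`λ_β = ev_β ∘ 𝒮`) and
`HeckeAlgebraDegree` (`deg : ℋ(G, K) →ₐ[k] k`, `T_{KgK} ↦ #(KgK/K)`).

## The print

[CartierCorvallis1979] §IV (4.2)–(4.4): the spherical function of the unramified character `χ` is `Γ_χ`, and `ℋ(G, K)` acts
on it by `f ↦ Sf(χ)`; for `χ = δ^{-1/2}` (the parameter of the TRIVIAL representation, `Γ_{δ^{-1/2}} = 1`) this character is
`f ↦ ∫_G f(g) dg`, i.e. `𝟙_{KgK} ↦ vol(KgK) = #(KgK/K)` — the degree of [ShimuraIATAF1971] Prop. 3.3.  In the discrete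
normalisation of `HyperspecialUnitarySatakeTransform` (`𝒮(T) = ∑_γ (T[K₀])(γ) q^{-⟨ν, a(γ)⟩/2} x^{a(γ)}`) the point is
`β₀ = (q^{(N-1-i)/2})_i`: `q^{-⟨ν, a⟩/2} β₀^a = 1`, so `λ_{β₀}(T) = ∑_γ (T[K₀])(γ) = deg T`.

## What is formalised

* `satakeWeight_mul_prod_pow_eq_one` — `q^{-⟨ν,a⟩/2} · ∏_i (q^{(N-1-i)/2})^{a_i} = 1`.
* **`heckeEigencharacter_trivialPoint_eq_degree`** — `λ_{β₀} = deg` as algebra homomorphisms `ℋ(U(σ, J₀), K₀) →ₐ[ℂ] ℂ`,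
  `β₀_i = (√q)^{N-1-i}`; `heckeEigencharacter_trivialPoint_doubleCosetOperator` (`λ_{β₀}(T_g) = #(K₀gK₀/K₀)`).

## References
* [CartierCorvallis1979] P. Cartier, *Representations of 𝔭-adic groups: a survey*, PSPM 33.1 (1979), §IV (4.2)–(4.4).
* [ShimuraIATAF1971] G. Shimura, *Introduction to the arithmetic theory of automorphic functions* (1971), §3.1, Prop. 3.3.
-/

noncomputable section

open scoped Valued WithZero Matrix MatrixGroups
open MonoidAlgebra Representation Finset

namespace Literature.NumberTheory.Automorphic.HermitianLattice

open Literature.NumberTheory.Automorphic.CartanUnique Literature.NumberTheory.Automorphic.SymplecticCartan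

variable {K : Type*} [Field K] [Valued K ℤᵐ⁰] {σ : K →+* K} {ϖ : K} {N : ℕ}

/-- **`q^{-⟨ν, a⟩/2} · ∏_i ((√q)^{N-1-i})^{a_i} = 1`**: the weight of the Satake transform cancels against the monomial of
the point `β₀ = ((√q)^{N-1-i})_i` (`c ≠ 0` any base). [cite: CartierCorvallis1979, §IV (4.2)] -/
theorem satakeWeight_mul_prod_pow_eq_one {c : ℂ} (hc : c ≠ 0) (a : Fin N → ℤ) :
    satakeWeight c a * ∏ i : Fin N, (c ^ (((N : ℤ) - 1 - (i : ℕ)))) ^ a i = 1 := by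
  rw [satakeWeight, satakeTwistExp]
  rw [Finset.prod_congr rfl fun i _ => (zpow_mul c _ _).symm]
  have h : ∏ i : Fin N, c ^ (((N : ℤ) - 1 - (i : ℕ)) * a i) = c ^ ∑ i : Fin N, ((N : ℤ) - 1 - (i : ℕ)) * a i := by
    classical
    induction (Finset.univ : Finset (Fin N)) using Finset.induction_on with
    | empty => simp
    | insert j s hj ih => rw [Finset.prod_insert hj, Finset.sum_insert hj, ih, zpow_add₀ hc]
  rw [h, ← zpow_add₀ hc, neg_add_cancel, zpow_zero]

variable [Finite 𝓀[K]]

namespace UnramifiedLocalConjDatum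

/-- **THE DEGREE CHARACTER IS THE UNRAMIFIED EIGENCHARACTER AT `β₀ = ((√q)^{N-1-i})_i`** (the Satake parameter of the trivial
representation, `χ = δ_B^{-1/2}`): `λ_{β₀} = deg` on `ℋ(U(σ, J₀), K₀)`. [cite: CartierCorvallis1979, §IV (4.2)–(4.4)]
[cite: ShimuraIATAF1971, §3.1 Prop. 3.3] -/
theorem heckeEigencharacter_trivialPoint_eq_degree (hd : UnramifiedLocalConjDatum σ ϖ) :
    hd.heckeEigencharacter (N := N) (fun i => Units.mk0 (residueCardSqrt K ^ (((N : ℤ) - 1 - (i : ℕ)))) (zpow_ne_zero _ residueCardSqrt_ne_zero)) =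
      heckeAlgebra.degree (unitaryInt σ ((StdForm.antidiagonal N).over K)) := by
  refine AlgHom.ext fun T => ?_
  rw [heckeEigencharacter_apply, satakeTransform_apply, satakeVec_apply, map_sum, heckeAlgebra.degree_eq_sum]
  refine Finset.sum_congr rfl fun γ _ => ?_
  rw [map_smul, laurentEvalAt_single, smul_eq_mul]
  simp only [Units.val_mk0]
  rw [satakeWeight_mul_prod_pow_eq_one residueCardSqrt_ne_zero, mul_one]

/-- **`λ_{β₀}(T_g) = #(K₀ g K₀ / K₀)`**: the unramified eigenvalue at the trivial point is the degree of the double coset.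
[cite: ShimuraIATAF1971, §3.1 Prop. 3.3] [cite: CartierCorvallis1979, §IV (4.2)] -/
theorem heckeEigencharacter_trivialPoint_doubleCosetOperator (hd : UnramifiedLocalConjDatum σ ϖ)
    [IsHeckeTriple (⊤ : Submonoid (unitaryGroupOfForm σ ((StdForm.antidiagonal N).over K)))
      (unitaryInt σ ((StdForm.antidiagonal N).over K)) (unitaryInt σ ((StdForm.antidiagonal N).over K))]
    (g : unitaryGroupOfForm σ ((StdForm.antidiagonal N).over K)) :
    hd.heckeEigencharacter (fun i => Units.mk0 (residueCardSqrt K ^ (((N : ℤ) - 1 - (i : ℕ)))) (zpow_ne_zero _ residueCardSqrt_ne_zero))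
        (heckeAlgebra.doubleCosetOperator (unitaryInt σ ((StdForm.antidiagonal N).over K)) g) =
      ((finite_orbit_quotient (unitaryInt σ ((StdForm.antidiagonal N).over K)) g).toFinset.card : ℂ) := by
  rw [heckeEigencharacter_trivialPoint_eq_degree, heckeAlgebra.degree_doubleCosetOperator]

end UnramifiedLocalConjDatum

end Literature.NumberTheory.Automorphic.HermitianLattice

end
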